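import Summits.AtomisticToContinuum.HydrodynamicLimit.Theorems.JParityClosureLocalSecondLawComposition

/-!
# `LocalSecondLaw` from the entropy ledger — the frame-free composition kernel and the PRE-SHOCK (C′) composition
(stmt-AtomisticToContinuum-13081, line `exact-entropy-ledger-three-passivities`, continuation lead c5)

Companion of `Theorems/JParityClosureLocalSecondLawComposition.lean` (`localSecondLaw_of_passivities : F → P1 → P2 → P3 →
LocalSecondLaw`, all quantifiers of the filed all-`τ` frame).  Two additions, both sorry-free bookkeeping over the LANDED
pathwise ledger `stub_ledger` (…Ledger.lean) and the LANDED initial layer `stub_initialLayer` (…InitialLayer.lean):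

* `measure_cruxEvent_le_five` — the composition with every frame quantifier stripped: for ANY measure `μ` on phase space,
  any particle number, any horizon `τ > 0`, any floor/cap `(c, η₁)` inside an EOS band and any smooth non-negative test
  function supported before `τ`, the crux event `{entropyFunctional + ∫H(ρ₀,θ₀)φ(0) < −η}` has `μ`-measure at most the sum
  of the five events `{∫H(ρ₀,θ₀)φ(0) < bdry − η/4}`, `Regularᶜ`, `{Regular ∧ Tᵢ < −η/4}` (`i = 1,2,3`).  This is the
  part of the line that is independent of how the crux is quantified (all `τ` / `τ < T` / packing guard / other laws).
* `localSecondLawInBand_of_passivities_preShock` — the composition in the RESTATED frame C′ asked for by leads c1/c4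
  (`Cruxes/LocalSecondLaw/Restatement.lean`, `LocalSecondLawInBand`: the filed text with `τ < T →` after `0 < τ →` and the
  packing guard `∃ η₀ > 0 … (∀ t ∈ Ico 0 T, ∀ x, ρ t x * σ ^ 3 < η₀) →` after the Euler hypothesis; the conclusion below
  is that checked text VERBATIM): from the pre-shock, guarded regular range F′ (= F + `τ < T` + the guard at a level
  `ηg < η₁` — the form `DensityCap` (stmt-13082) plus the guard produces for the cap third) and the pre-shock passivities
  P1′, P2′, P3′ (= P1, P2, P3 + `τ < T` — the form the pre-shock kinetic cruxes OddContactSymmetry 17722 / RateFloor 13080 /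
  EvenStressEnskog 13079 feed through the landed reductions, whose deterministic cores are pathwise).  Thresholds: guard
  level `η₀/4` and cap `η₁ := η₀/2` inside the EOS band `(η₀, F)` of the PROVED `HsEosLowDensity`; then `σ₀ := min`,
  `c` from F′ at `δ/5`, `r₀ := min`, `N₀ := max`, and `measure_cruxEvent_le_five` under the local Gibbs law.

Nothing here closes the item: the filed decl is the all-`τ` text (see `Cruxes/LocalSecondLaw/VERDICT-c4.md`); this file is
the line's registered composition transported to the restatement, so that a re-typed crux has its skeleton on day one.

References: E. Feireisl, A. Novotný, *Singular Limits in Thermodynamics of Viscous Fluids* (2009/2017), §2 (entropy /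
entropy-flux bookkeeping); J. Březina, E. Feireisl, J. Math. Soc. Japan 70 (2018) 1227 (the admissibility consumed on `[0,T)`).
-/

noncomputable section

namespace Summit.AtomisticToContinuum.HydrodynamicLimit.Theorems.LocalSecondLawLedger

open scoped BigOperators Topology ENNReal InnerProductSpace
open Filter Set MeasureTheory
open Literature.MathematicalPhysics.KineticTheory
open Literature.Analysis.FluidPDE
open Summit.AtomisticToContinuum.HydrodynamicLimit.Theses
open Summit.AtomisticToContinuum.HydrodynamicLimit.Theorems.LocalSecondLawNegative

/-- **The frame-free composition kernel.**  For any measure `μ` on the `(N+1)`-sphere phase space, any flow, any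
horizon `τ > 0`, floor/cap `(c, η₁)` with `η₁` inside an EOS band, and any smooth `φ ≥ 0` supported before `τ`: the crux
event `{entropyFunctional + ∫ H(ρ₀,θ₀) φ(0) < −η}` is contained in
`{∫H(ρ₀,θ₀)φ(0) < bdry − η/4} ∪ Regularᶜ ∪ ⋃ᵢ {Regular ∧ Tᵢ < −η/4}` by the landed pathwise ledger
`T₁ + T₂ + T₃ ≤ entropyFunctional + bdry` on `Regular` (`stub_ledger`), whence the five-term union bound.  No sign or
size condition on `η`, no frame quantifier, no property of `μ`. -/
theorem measure_cruxEvent_le_five :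
  ∀ {η₀ : ℝ} {F : ℝ → ℝ}, EosBand η₀ F → ∀ {η₁ c σ r τ : ℝ}, η₁ < η₀ → 0 < c → 0 < σ → 0 < r → 0 < τ → ∀ {φ : ℝ → T3 → ℝ}, Literature.Analysis.FunctionSpaces.Torus.IsSmoothSpaceTimeOn Set.univ φ → (∀ s x, 0 ≤ φ s x) → (∃ τ' : ℝ, τ' < τ ∧ ∀ s, τ' ≤ s → ∀ x, φ s x = 0) → ∀ {N : ℕ} (Φ : Flow σ N) (μ : Measure (Phase N)) (ρ₀ θ₀ : T3 → ℝ) (η : ℝ), μ {z | entropyFunctional σ r τ φ Φ z + ∫ x : T3, Hs σ (ρ₀ x) (θ₀ x) * φ 0 x < -η} ≤ μ {z | (∫ x : T3, Hs σ (ρ₀ x) (θ₀ x) * φ 0 x) < bdry σ r (φ 0) Φ z - η / 4} + μ {z | ¬ Regular σ r τ c η₁ Φ z} + μ {z | Regular σ r τ c η₁ Φ z ∧ T₁ σ r τ φ Φ z < -(η / 4)} + μ {z | Regular σ r τ c η₁ Φ z ∧ T₂ σ r τ φ Φ z < -(η / 4)} + μ {z | Regular σ r τ c η₁ Φ z ∧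 T₃ σ r τ φ Φ z < -(η / 4)} := by
  intro η₀ F hband η₁ c σ r τ hη₁ hc hσ hr hτ φ hφ hφ0 hsupp N Φ μ ρ₀ θ₀ η
  -- the deterministic ledger at this `N`
  have hLed : ∀ z : Phase N, Regular σ r τ c η₁ Φ z →
      T₁ σ r τ φ Φ z + T₂ σ r τ φ Φ z + T₃ σ r τ φ Φ z ≤
        entropyFunctional σ r τ φ Φ z + bdry σ r (φ 0) Φ z :=
    fun z hz => stub_ledger η₀ F hband η₁ c σ r τ hη₁ hc hσ hr hτ φ hφ hφ0 hsupp N Φ z hz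
  -- event inclusion
  have hsub : {z | entropyFunctional σ r τ φ Φ z + ∫ x : T3, Hs σ (ρ₀ x) (θ₀ x) * φ 0 x < -η} ⊆
      {z | (∫ x : T3, Hs σ (ρ₀ x) (θ₀ x) * φ 0 x) < bdry σ r (φ 0) Φ z - η / 4} ∪
        {z | ¬ Regular σ r τ c η₁ Φ z} ∪
        {z | Regular σ r τ c η₁ Φ z ∧ T₁ σ r τ φ Φ z < -(η / 4)} ∪
        {z | Regular σ r τ c η₁ Φ z ∧ T₂ σ r τ φ Φ z < -(η / 4)} ∪
        {z | Regular σ r τ c η₁ Φ z ∧ T₃ σ r τ φ Φ z < -(η / 4)} := by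
    intro z hz
    simp only [Set.mem_setOf_eq] at hz
    by_contra hcon
    simp only [Set.mem_union, Set.mem_setOf_eq, not_or, not_and, not_lt, not_not] at hcon
    obtain ⟨⟨⟨⟨hB0, hReg⟩, h10⟩, h20⟩, h30⟩ := hcon
    have h1 := h10 hReg
    have h2 := h20 hReg
    have h3 := h30 hReg
    have hL0 := hLed z hReg
    linarith
  calc μ {z | entropyFunctional σ r τ φ Φ z + ∫ x : T3, Hs σ (ρ₀ x) (θ₀ x) * φ 0 x < -η}
      ≤ μ ({z | (∫ x : T3, Hs σ (ρ₀ x) (θ₀ x) * φ 0 x) < bdry σ r (φ 0) Φ z - η / 4} ∪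
            {z | ¬ Regular σ r τ c η₁ Φ z} ∪
            {z | Regular σ r τ c η₁ Φ z ∧ T₁ σ r τ φ Φ z < -(η / 4)} ∪
            {z | Regular σ r τ c η₁ Φ z ∧ T₂ σ r τ φ Φ z < -(η / 4)} ∪
            {z | Regular σ r τ c η₁ Φ z ∧ T₃ σ r τ φ Φ z < -(η / 4)}) :=
        measure_mono hsub
    _ ≤ μ ({z | (∫ x : T3, Hs σ (ρ₀ x) (θ₀ x) * φ 0 x) < bdry σ r (φ 0) Φ z - η / 4} ∪
            {z | ¬ Regular σ r τ c η₁ Φ z} ∪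
            {z | Regular σ r τ c η₁ Φ z ∧ T₁ σ r τ φ Φ z < -(η / 4)} ∪
            {z | Regular σ r τ c η₁ Φ z ∧ T₂ σ r τ φ Φ z < -(η / 4)}) +
        μ {z | Regular σ r τ c η₁ Φ z ∧ T₃ σ r τ φ Φ z < -(η / 4)} :=
        measure_union_le _ _
    _ ≤ μ ({z | (∫ x : T3, Hs σ (ρ₀ x) (θ₀ x) * φ 0 x) < bdry σ r (φ 0) Φ z - η / 4} ∪
            {z | ¬ Regular σ r τ c η₁ Φ z} ∪
            {z | Regular σ r τ c η₁ Φ z ∧ T₁ σ r τ φ Φ z < -(η / 4)}) +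
        μ {z | Regular σ r τ c η₁ Φ z ∧ T₂ σ r τ φ Φ z < -(η / 4)} +
        μ {z | Regular σ r τ c η₁ Φ z ∧ T₃ σ r τ φ Φ z < -(η / 4)} :=
        add_le_add (measure_union_le _ _) le_rfl
    _ ≤ μ ({z | (∫ x : T3, Hs σ (ρ₀ x) (θ₀ x) * φ 0 x) < bdry σ r (φ 0) Φ z - η / 4} ∪
            {z | ¬ Regular σ r τ c η₁ Φ z}) +
        μ {z | Regular σ r τ c η₁ Φ z ∧ T₁ σ r τ φ Φ z < -(η / 4)} +
        μ {z | Regular σ r τ c η₁ Φ z ∧ T₂ σ r τ φ Φ z < -(η / 4)} +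
        μ {z | Regular σ r τ c η₁ Φ z ∧ T₃ σ r τ φ Φ z < -(η / 4)} :=
        add_le_add (add_le_add (measure_union_le _ _) le_rfl) le_rfl
    _ ≤ μ {z | (∫ x : T3, Hs σ (ρ₀ x) (θ₀ x) * φ 0 x) < bdry σ r (φ 0) Φ z - η / 4} +
        μ {z | ¬ Regular σ r τ c η₁ Φ z} +
        μ {z | Regular σ r τ c η₁ Φ z ∧ T₁ σ r τ φ Φ z < -(η / 4)} +
        μ {z | Regular σ r τ c η₁ Φ z ∧ T₂ σ r τ φ Φ z < -(η / 4)} +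
        μ {z | Regular σ r τ c η₁ Φ z ∧ T₃ σ r τ φ Φ z < -(η / 4)} :=
        add_le_add (add_le_add (add_le_add (measure_union_le _ _) le_rfl) le_rfl) le_rfl

/-- Arithmetic of the five-way split: `5 · ofReal (δ/5) = ofReal δ` for `δ > 0`. -/
theorem ofReal_fifth_sum {δ : ℝ} (hδ : 0 < δ) :
    ENNReal.ofReal (δ / 5) + ENNReal.ofReal (δ / 5) + ENNReal.ofReal (δ / 5) +
        ENNReal.ofReal (δ / 5) + ENNReal.ofReal (δ / 5) = ENNReal.ofReal δ := by
  have hδ5 : (0 : ℝ) ≤ δ / 5 := by positivity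
  have h2 : (0 : ℝ) ≤ δ / 5 + δ / 5 := by positivity
  have h3 : (0 : ℝ) ≤ δ / 5 + δ / 5 + δ / 5 := by positivity
  have h4 : (0 : ℝ) ≤ δ / 5 + δ / 5 + δ / 5 + δ / 5 := by positivity
  rw [← ENNReal.ofReal_add hδ5 hδ5, ← ENNReal.ofReal_add h2 hδ5, ← ENNReal.ofReal_add h3 hδ5,
    ← ENNReal.ofReal_add h4 hδ5]
  congr 1
  ring

/-- **C′ (`LocalSecondLawInBand`) from the pre-shock, guarded regular range and the three pre-shock passivities.**
The conclusion is the checked restatement text of `Cruxes/LocalSecondLaw/Restatement.lean` verbatim (leading `∃ η₀ > 0`,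
packing guard after the Euler hypothesis, `τ < T →` after `0 < τ →`).  Hypotheses, in order:
F′ — for every cap `η₁` and guard level `0 < ηg < η₁`: in the crux frame, for a classical solution whose reduced density stays
below `ηg` on `[0,T)` and every `τ < T`, w.h.p. the orbit is good and the coarse fields keep a density floor/cap
`[c, η₁/σ³]` and a temperature floor `c` on `[0,τ] × 𝕋³`, `c = c(δ, …)` chosen before `r₀`;
P1′/P2′/P3′ — the registered passivities `P(Regular ∧ Tᵢ < −η) ≤ δ` with the single extra hypothesis `τ < T`.
Proof: EOS band `(η₀, F)` from the proved `HsEosLowDensity`; witness `η₀/4` for the guard level, cap `η₁ := η₀/2`;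
B = `stub_initialLayer` and L (inside `measure_cruxEvent_le_five`) are landed theorems; thresholds by `min`/`max`. -/
theorem localSecondLawInBand_of_passivities_preShock :
  (∀ η₁ ηg : ℝ, 0 < ηg → ηg < η₁ → ∀ (a₀ θ₀ : T3 → ℝ) (u₀ : T3 → V3), Continuous a₀ → Continuous θ₀ → Continuous u₀ → (∀ x, 0 < a₀ x) → (∀ x, 0 < θ₀ x) → ∃ σ₀ : ℝ, 0 < σ₀ ∧ ∀ σ : ℝ, 0 < σ → σ < σ₀ → ∀ (T : ℝ) (ρ θ : ℝ → T3 → ℝ) (u : ℝ → T3 → V3), IsHardSphereEulerSolution σ T ρ u θ → (∀ t ∈ Set.Ico 0 T, ∀ x, ρ t x * σ ^ 3 < ηg) → ∀ Φ : (N : ℕ) → Flow σ N, TendstoHydroFieldsAt (fun N => localGibbsLaw σ a₀ u₀ θ₀ N (Φ N)) Φ ρ u θ 0 → 0 < T → ∀ τ : ℝ, 0 < τ → τ < T → ∀ δ : ℝ, 0 < δ → ∃ c : ℝ, 0 < c ∧ ∃ r₀ : ℝ, 0 < r₀ ∧ ∀ r : ℝ, 0 < r → r < r₀ → ∃ N₀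 : ℕ, ∀ N : ℕ, N₀ ≤ N → localGibbsLaw σ a₀ u₀ θ₀ N (Φ N) {z | ¬ Regular σ r τ c η₁ (Φ N) z} ≤ ENNReal.ofReal δ) →
  (∀ (a₀ θ₀ : T3 → ℝ) (u₀ : T3 → V3), Continuous a₀ → Continuous θ₀ → Continuous u₀ → (∀ x, 0 < a₀ x) → (∀ x, 0 < θ₀ x) → ∃ σ₀ : ℝ, 0 < σ₀ ∧ ∀ σ : ℝ, 0 < σ → σ < σ₀ → ∀ (T : ℝ) (ρ θ : ℝ → T3 → ℝ) (u : ℝ → T3 → V3), IsHardSphereEulerSolution σ T ρ u θ → ∀ Φ : (N : ℕ) → Flow σ N, TendstoHydroFieldsAt (fun N => localGibbsLaw σ a₀ u₀ θ₀ N (Φ N)) Φ ρ u θ 0 → 0 < T → ∀ τ : ℝ, 0 < τ → τ < T → ∀ φ : ℝ → T3 → ℝ, Literature.Analysis.FunctionSpaces.Torus.IsSmoothSpaceTimeOn Set.univ φ → (∀ s x, 0 ≤ φ s x) → (∃ τ' : ℝ, τ' < τ ∧ ∀ s, τ' ≤ s → ∀ x, φ s x = 0) → ∀ c η₁ : ℝ,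 0 < c → ∀ η δ : ℝ, 0 < η → 0 < δ → ∃ r₀ : ℝ, 0 < r₀ ∧ ∀ r : ℝ, 0 < r → r < r₀ → ∃ N₀ : ℕ, ∀ N : ℕ, N₀ ≤ N → localGibbsLaw σ a₀ u₀ θ₀ N (Φ N) {z | Regular σ r τ c η₁ (Φ N) z ∧ T₁ σ r τ φ (Φ N) z < -η} ≤ ENNReal.ofReal δ) →
  (∀ (η₀ : ℝ) (F : ℝ → ℝ), EosBand η₀ F → ∀ η₁ : ℝ, 0 < η₁ → η₁ < η₀ → ∀ (a₀ θ₀ : T3 → ℝ) (u₀ : T3 → V3), Continuous a₀ → Continuous θ₀ → Continuous u₀ → (∀ x, 0 < a₀ x) → (∀ x, 0 < θ₀ x) → ∃ σ₀ : ℝ, 0 < σ₀ ∧ ∀ σ : ℝ, 0 < σ → σ < σ₀ → ∀ (T : ℝ) (ρ θ : ℝ → T3 → ℝ) (u : ℝ → T3 → V3), IsHardSphereEulerSolution σ T ρ u θ → ∀ Φ : (N : ℕ) → Flow σ N, TendstoHydroFieldsAt (fun N => localGibbsLaw σ a₀ u₀ θ₀ N (Φ N)) Φ ρ u θ 0 →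 0 < T → ∀ τ : ℝ, 0 < τ → τ < T → ∀ φ : ℝ → T3 → ℝ, Literature.Analysis.FunctionSpaces.Torus.IsSmoothSpaceTimeOn Set.univ φ → (∀ s x, 0 ≤ φ s x) → (∃ τ' : ℝ, τ' < τ ∧ ∀ s, τ' ≤ s → ∀ x, φ s x = 0) → ∀ c : ℝ, 0 < c → ∀ η δ : ℝ, 0 < η → 0 < δ → ∃ r₀ : ℝ, 0 < r₀ ∧ ∀ r : ℝ, 0 < r → r < r₀ → ∃ N₀ : ℕ, ∀ N : ℕ, N₀ ≤ N → localGibbsLaw σ a₀ u₀ θ₀ N (Φ N) {z | Regular σ r τ c η₁ (Φ N) z ∧ T₂ σ r τ φ (Φ N) z < -η} ≤ ENNReal.ofReal δ) →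
  (∀ (a₀ θ₀ : T3 → ℝ) (u₀ : T3 → V3), Continuous a₀ → Continuous θ₀ → Continuous u₀ → (∀ x, 0 < a₀ x) → (∀ x, 0 < θ₀ x) → ∃ σ₀ : ℝ, 0 < σ₀ ∧ ∀ σ : ℝ, 0 < σ → σ < σ₀ → ∀ (T : ℝ) (ρ θ : ℝ → T3 → ℝ) (u : ℝ → T3 → V3), IsHardSphereEulerSolution σ T ρ u θ → ∀ Φ : (N : ℕ) → Flow σ N, TendstoHydroFieldsAt (fun N => localGibbsLaw σ a₀ u₀ θ₀ N (Φ N)) Φ ρ u θ 0 → 0 < T → ∀ τ : ℝ, 0 < τ → τ < T → ∀ φ : ℝ → T3 → ℝ, Literature.Analysis.FunctionSpaces.Torus.IsSmoothSpaceTimeOn Set.univ φ → (∀ s x, 0 ≤ φ s x) → (∃ τ' : ℝ, τ' < τ ∧ ∀ s, τ' ≤ s → ∀ x, φ s x = 0) → ∀ c η₁ : ℝ, 0 < c → ∀ η δ : ℝ, 0 < η → 0 < δ → ∃ r₀ : ℝ, 0 < r₀ ∧ ∀ r : ℝ, 0 < r → r < r₀ → ∃ N₀ : ℕ, ∀ N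 : ℕ, N₀ ≤ N → localGibbsLaw σ a₀ u₀ θ₀ N (Φ N) {z | Regular σ r τ c η₁ (Φ N) z ∧ T₃ σ r τ φ (Φ N) z < -η} ≤ ENNReal.ofReal δ) →
  ∃ η₀ : ℝ, 0 < η₀ ∧ ∀ (a₀ θ₀ : Literature.MathematicalPhysics.KineticTheory.T3 → ℝ) (u₀ : Literature.MathematicalPhysics.KineticTheory.T3 → Literature.MathematicalPhysics.KineticTheory.V3), Continuous a₀ → Continuous θ₀ → Continuous u₀ → (∀ x, 0 < a₀ x) → (∀ x, 0 < θ₀ x) → ∃ σ₀ : ℝ, 0 < σ₀ ∧ ∀ σ : ℝ, 0 < σ → σ < σ₀ → ∀ (T : ℝ) (ρ θ : ℝ → Literature.MathematicalPhysics.KineticTheory.T3 → ℝ) (u : ℝ → Literature.MathematicalPhysics.KineticTheory.T3 → Literature.MathematicalPhysics.KineticTheory.V3), Literature.MathematicalPhysics.KineticTheory.IsHardSphereEulerSolution σ T ρ u θ → (∀ t ∈ Set.Ico 0 T, ∀ x, ρ t x * σ ^ 3 < η₀) → ∀ Φ : (N : ℕ) → Literature.Analysis.FluidPDE.HardSphereFlow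 (Literature.Analysis.FluidPDE.Torus.geometry (Fin 3)) (Literature.MathematicalPhysics.KineticTheory.hsDiameter σ N) (N + 1), Literature.MathematicalPhysics.KineticTheory.TendstoHydroFieldsAt (fun N => Literature.MathematicalPhysics.KineticTheory.localGibbsLaw σ a₀ u₀ θ₀ N (Φ N)) Φ ρ u θ 0 → 0 < T → ∀ τ : ℝ, 0 < τ → τ < T → ∀ φ : ℝ → Literature.MathematicalPhysics.KineticTheory.T3 → ℝ, Literature.Analysis.FunctionSpaces.Torus.IsSmoothSpaceTimeOn Set.univ φ → (∀ s x, 0 ≤ φ s x) → (∃ τ' : ℝ, τ' < τ ∧ ∀ s, τ' ≤ s → ∀ x, φ s x = 0) → ∀ η δ : ℝ, 0 < η → 0 < δ → ∃ r₀ : ℝ, 0 < r₀ ∧ ∀ r : ℝ, 0 < r → r < r₀ → ∃ N₀ : ℕ, ∀ N : ℕ, N₀ ≤ N → let γ : Literature.Analysis.FluidPDE.Config (N + 1) (Fin 3) Literature.MathematicalPhysics.KineticTheory.T3 → ℝ → Literature.Analysis.FluidPDE.Config (N + 1) (Fin 3) Literature.MathematicalPhysics.KineticTheory.T3 := fun z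 s => (Φ N).flow s z; let bx : Literature.MathematicalPhysics.KineticTheory.T3 → Literature.MathematicalPhysics.KineticTheory.T3 → ℝ := fun x y => 3 / (Real.pi * r ^ 3) * max (1 - Literature.Analysis.FluidPDE.Torus.euclidDist x y / r) 0; let ρm : Literature.Analysis.FluidPDE.Config (N + 1) (Fin 3) Literature.MathematicalPhysics.KineticTheory.T3 → ℝ → Literature.MathematicalPhysics.KineticTheory.T3 → ℝ := fun z s x₀ => ∫ q, bx q.1 x₀ ∂(Literature.Analysis.FluidPDE.empiricalMeasure (γ z s)); let mm : Literature.Analysis.FluidPDE.Config (N + 1) (Fin 3) Literature.MathematicalPhysics.KineticTheory.T3 → ℝ → Literature.MathematicalPhysics.KineticTheory.T3 → Literature.MathematicalPhysics.KineticTheory.V3 := fun z s x₀ => ∫ q, bx q.1 x₀ • q.2 ∂(Literature.Analysis.FluidPDE.empiricalMeasure (γ z s)); let em : Literature.Analysis.FluidPDE.Config (N + 1) (Fin 3) Literature.MathematicalPhysics.KineticTheory.T3 → ℝ → Literature.MathematicalPhysics.KineticTheory.T3 → ℝ := fun z s x₀ => ∫ q, bx q.1 x₀ * (‖q.2‖ ^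 2 / 2) ∂(Literature.Analysis.FluidPDE.empiricalMeasure (γ z s)); let θm : Literature.Analysis.FluidPDE.Config (N + 1) (Fin 3) Literature.MathematicalPhysics.KineticTheory.T3 → ℝ → Literature.MathematicalPhysics.KineticTheory.T3 → ℝ := fun z s x₀ => 2 / 3 * (em z s x₀ / ρm z s x₀ - ‖mm z s x₀‖ ^ 2 / (2 * ρm z s x₀ ^ 2)); let Hs : ℝ → ℝ → ℝ := fun a b => if 0 < a ∧ 0 < b then -(a * (3 / 2 * Real.log b - Real.log a - Literature.MathematicalPhysics.KineticTheory.hsExcessFreeEnergy (a * σ ^ 3))) else 0; let I : Literature.Analysis.FluidPDE.Config (N + 1) (Fin 3) Literature.MathematicalPhysics.KineticTheory.T3 → ℝ := fun z => ∫ s in Set.Icc (0 : ℝ) τ, ∫ x : Literature.MathematicalPhysics.KineticTheory.T3, Hs (ρm z s x) (θm z s x) * (deriv (fun s' => φ s' x) s + ∑ k : Fin 3, (mm z s x) k / ρm z s x * Literature.Analysis.FunctionSpaces.Torus.partialDeriv k (φ s) x); Literature.MathematicalPhysics.KineticTheory.localGibbsLaw σ a₀ u₀ θ₀ N (Φ N)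 {z | I z + ∫ x : Literature.MathematicalPhysics.KineticTheory.T3, Hs (ρ 0 x) (θ 0 x) * φ 0 x < -η} ≤ ENNReal.ofReal δ := by
  intro hF hP1 hP2 hP3
  have hEos : JParityClosure.HsEosLowDensity :=
    Summit.AtomisticToContinuum.HydrodynamicLimit.Theorems.hsEosLowDensity_proof
  obtain ⟨η₀, hη₀, F, hFan, hFeq, -, -, -⟩ := hEos
  have hband : EosBand η₀ F := ⟨hη₀, hFan, hFeq⟩
  have hη₁ : (0 : ℝ) < η₀ / 2 := by positivity
  have hη₁lt : η₀ / 2 < η₀ := by linarith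
  have hηg : (0 : ℝ) < η₀ / 4 := by positivity
  have hηglt : η₀ / 4 < η₀ / 2 := by linarith
  refine ⟨η₀ / 4, hηg, ?_⟩
  intro a₀ θ₀ u₀ ha hθ hu ha0 hθ0
  obtain ⟨σB, hσB, HB⟩ := stub_initialLayer η₀ F hband a₀ θ₀ u₀ ha hθ hu ha0 hθ0
  obtain ⟨σF, hσF, HF⟩ := hF (η₀ / 2) (η₀ / 4) hηg hηglt a₀ θ₀ u₀ ha hθ hu ha0 hθ0
  obtain ⟨σ₁, hσ₁, H1⟩ := hP1 a₀ θ₀ u₀ ha hθ hu ha0 hθ0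
  obtain ⟨σ₂, hσ₂, H2⟩ := hP2 η₀ F hband (η₀ / 2) hη₁ hη₁lt a₀ θ₀ u₀ ha hθ hu ha0 hθ0
  obtain ⟨σ₃, hσ₃, H3⟩ := hP3 a₀ θ₀ u₀ ha hθ hu ha0 hθ0
  refine ⟨min (min σB σF) (min σ₁ (min σ₂ σ₃)),
    lt_min (lt_min hσB hσF) (lt_min hσ₁ (lt_min hσ₂ hσ₃)), ?_⟩
  intro σ hσ hσlt T ρ θ u hE hguard Φ h0 hT τ hτ hτT φ hφ hφ0 hsupp η δ hη hδ
  have hσB' : σ < σB := lt_of_lt_of_le hσlt ((min_le_left _ _).trans (min_le_left _ _))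
  have hσF' : σ < σF := lt_of_lt_of_le hσlt ((min_le_left _ _).trans (min_le_right _ _))
  have hσ1' : σ < σ₁ := lt_of_lt_of_le hσlt ((min_le_right _ _).trans (min_le_left _ _))
  have hσ2' : σ < σ₂ :=
    lt_of_lt_of_le hσlt ((min_le_right _ _).trans ((min_le_right _ _).trans (min_le_left _ _)))
  have hσ3' : σ < σ₃ :=
    lt_of_lt_of_le hσlt ((min_le_right _ _).trans ((min_le_right _ _).trans (min_le_right _ _)))
  have hη4 : (0 : ℝ) < η / 4 := by positivity
  have hδ5 : (0 : ℝ) < δ / 5 := by positivity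
  -- the floor, chosen before the resolution (F′ at cap `η₀/2`, guard `η₀/4`, horizon `τ < T`)
  obtain ⟨c, hc, rF, hrF, HF'⟩ := HF σ hσ hσF' T ρ θ u hE hguard Φ h0 hT τ hτ hτT (δ / 5) hδ5
  -- the resolutions
  obtain ⟨rB, hrB, HB'⟩ := HB σ hσ hσB' T ρ θ u hE Φ h0 hT φ hφ hφ0 (η / 4) (δ / 5) hη4 hδ5
  obtain ⟨r₁, hr₁, H1'⟩ :=
    H1 σ hσ hσ1' T ρ θ u hE Φ h0 hT τ hτ hτT φ hφ hφ0 hsupp c (η₀ / 2) hc (η / 4) (δ / 5) hη4 hδ5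
  obtain ⟨r₂, hr₂, H2'⟩ :=
    H2 σ hσ hσ2' T ρ θ u hE Φ h0 hT τ hτ hτT φ hφ hφ0 hsupp c hc (η / 4) (δ / 5) hη4 hδ5
  obtain ⟨r₃, hr₃, H3'⟩ :=
    H3 σ hσ hσ3' T ρ θ u hE Φ h0 hT τ hτ hτT φ hφ hφ0 hsupp c (η₀ / 2) hc (η / 4) (δ / 5) hη4 hδ5
  refine ⟨min (min rB rF) (min r₁ (min r₂ r₃)),
    lt_min (lt_min hrB hrF) (lt_min hr₁ (lt_min hr₂ hr₃)), ?_⟩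
  intro r hr hrlt
  have hrB' : r < rB := lt_of_lt_of_le hrlt ((min_le_left _ _).trans (min_le_left _ _))
  have hrF' : r < rF := lt_of_lt_of_le hrlt ((min_le_left _ _).trans (min_le_right _ _))
  have hr1' : r < r₁ := lt_of_lt_of_le hrlt ((min_le_right _ _).trans (min_le_left _ _))
  have hr2' : r < r₂ :=
    lt_of_lt_of_le hrlt ((min_le_right _ _).trans ((min_le_right _ _).trans (min_le_left _ _)))
  have hr3' : r < r₃ :=
    lt_of_lt_of_le hrlt ((min_le_right _ _).trans ((min_le_right _ _).trans (min_le_right _ _)))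
  obtain ⟨NB, HB''⟩ := HB' r hr hrB'
  obtain ⟨NF, HF''⟩ := HF' r hr hrF'
  obtain ⟨N₁, H1''⟩ := H1' r hr hr1'
  obtain ⟨N₂, H2''⟩ := H2' r hr hr2'
  obtain ⟨N₃, H3''⟩ := H3' r hr hr3'
  refine ⟨max (max NB NF) (max N₁ (max N₂ N₃)), ?_⟩
  intro N hN
  have hNB : NB ≤ N := ((le_max_left _ _).trans (le_max_left _ _)).trans hN
  have hNF : NF ≤ N := ((le_max_right _ _).trans (le_max_left _ _)).trans hN
  have hN1 : N₁ ≤ N := ((le_max_left _ _).trans (le_max_right _ _)).trans hN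
  have hN2 : N₂ ≤ N :=
    (((le_max_left _ _).trans (le_max_right _ _)).trans (le_max_right _ _)).trans hN
  have hN3 : N₃ ≤ N :=
    (((le_max_right _ _).trans (le_max_right _ _)).trans (le_max_right _ _)).trans hN
  -- the five probabilistic inputs at this `N`
  have EB := HB'' N hNB
  have EF := HF'' N hNF
  have E1 := H1'' N hN1
  have E2 := H2'' N hN2
  have E3 := H3'' N hN3
  -- rewrite the crux event through the named functional (definitional)
  change localGibbsLaw σ a₀ u₀ θ₀ N (Φ N)
      {z | entropyFunctional σ r τ φ (Φ N) z + ∫ x : T3, Hs σ (ρ 0 x) (θ 0 x) * φ 0 x < -η}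
    ≤ ENNReal.ofReal δ
  calc localGibbsLaw σ a₀ u₀ θ₀ N (Φ N)
        {z | entropyFunctional σ r τ φ (Φ N) z + ∫ x : T3, Hs σ (ρ 0 x) (θ 0 x) * φ 0 x < -η}
      ≤ localGibbsLaw σ a₀ u₀ θ₀ N (Φ N)
            {z | (∫ x : T3, Hs σ (ρ 0 x) (θ 0 x) * φ 0 x) < bdry σ r (φ 0) (Φ N) z - η / 4} +
          localGibbsLaw σ a₀ u₀ θ₀ N (Φ N) {z | ¬ Regular σ r τ c (η₀ / 2) (Φ N) z} +
          localGibbsLaw σ a₀ u₀ θ₀ N (Φ N)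
            {z | Regular σ r τ c (η₀ / 2) (Φ N) z ∧ T₁ σ r τ φ (Φ N) z < -(η / 4)} +
          localGibbsLaw σ a₀ u₀ θ₀ N (Φ N)
            {z | Regular σ r τ c (η₀ / 2) (Φ N) z ∧ T₂ σ r τ φ (Φ N) z < -(η / 4)} +
          localGibbsLaw σ a₀ u₀ θ₀ N (Φ N)
            {z | Regular σ r τ c (η₀ / 2) (Φ N) z ∧ T₃ σ r τ φ (Φ N) z < -(η / 4)} :=
        measure_cruxEvent_le_five hband hη₁lt hc hσ hr hτ hφ hφ0 hsupp (Φ N) _ (ρ 0) (θ 0) η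
    _ ≤ ENNReal.ofReal (δ / 5) + ENNReal.ofReal (δ / 5) + ENNReal.ofReal (δ / 5) +
          ENNReal.ofReal (δ / 5) + ENNReal.ofReal (δ / 5) :=
        add_le_add (add_le_add (add_le_add (add_le_add EB EF) E1) E2) E3
    _ = ENNReal.ofReal δ := ofReal_fifth_sum hδ

end Summit.AtomisticToContinuum.HydrodynamicLimit.Theorems.LocalSecondLawLedger

end
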